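import Summits.AtomisticToContinuum.FouriersLaw.Theses.BondHeatUncertainty
import Summits.AtomisticToContinuum.FouriersLaw.Theorems.BondHeatUncertaintySubdiffusiveBondHeatBathBondReductionTwoTime

/-!
# `SubdiffusiveBondHeat` / bath-bond reduction, part 4a: one-time laws, moments along the stationary flow, lag integrals

Helper file for crux `stmt-AtomisticToContinuum-9120` (`BondHeatUncertainty.SubdiffusiveBondHeat`), line
`bath-bond-deficit-integral`, stub `stub_bathBondReduction`. Preparations for the identity
`V_N(b,t) = E_{μ_T}[(∫₀ᵗ j_b(z_s) ds)²]` (part 4b, `…BathBondReductionVariance.lean`) between the crux's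
kernel-level bond-heat variance and the second moment of the time-integrated current along the constructed
flow `z_s = Φ_s(x, B)` started from an invariant law:

* `integral_integral_triangle_eq`, `setIntegral_square_lag_eq` — the elementary identities
  `∫₀ᵗ (∫₀ˢ a) ds = ∫₀ᵗ (t-r) a(r) dr` and `∫∫_{(0,t]²} F = ∫₀ᵗ (t-r)(a(r) + b(r)) dr` for
  `F(s,u) = a(u-s)` (`s < u`), `= b(s-u)` (`u ≤ s`), bounded measurable `a, b`;
* `pinnedChain_map_solMap_of_initial` / `…_of_invariant` — the ONE-TIME LAW of the flow: under `μ ⊗ W`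
  the law of `z_s` is `μP_s = μ.bind P_s` (`= μ` for an invariant `μ`; registered sub-goal
  `pinnedChain_oneTimeLaw`);
* `pinnedChain_lintegral_sq_solMap_of_invariant`, `pinnedChain_integrable_sq_solMap_of_invariant` —
  `E f(z_r)² = ∫ f² dμ` for every real `r` under an invariant law;
* `pinnedChain_integrable_mul_compProd_of_invariant` — `f ⊗ h ∈ L¹(μ ⊗ₘ P_t)` for `f, h ∈ L²(μ)`;
* `pinnedChain_integral_mul_solMap_of_invariant` — stationary two-time correlations at real times
  `0 ≤ s ≤ u`: `E[f(z_s) h(z_u)] = ∫ f · (P_{u-s} h) dμ` (from the two-time law of part 3).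

The invariance `μ.bind P_s = μ` is a HYPOTHESIS throughout (for the Gibbs measure it is clause (a) of
`BoundaryEscapeDeficit.BoundaryKernelBasics`, stmt-AtomisticToContinuum-12239). Nothing here closes an item.
-/

noncomputable section

open MeasureTheory ProbabilityTheory Filter Topology Set intervalIntegral
open scoped NNReal ENNReal
open Literature.MathematicalPhysics.KineticTheory.HeatConduction Literature.Probability.Process

namespace Summit.AtomisticToContinuum.FouriersLaw.Theorems.SubdiffusiveBondHeat

open OscillatorChain
/-! ### An elementary identity for integrals of lag functions over a square -/

/-- A bounded measurable function is interval integrable (Lebesgue measure). [folklore] -/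
theorem intervalIntegrable_of_bounded_measurable {c : ℝ → ℝ} (hc : Measurable c) {B : ℝ}
    (hB : ∀ r, |c r| ≤ B) (a b : ℝ) : IntervalIntegrable c volume a b := by
  refine (intervalIntegrable_const (c := B)).mono_fun' hc.aestronglyMeasurable ?_
  exact Eventually.of_forall fun r => by simpa [Real.norm_eq_abs] using hB r

/-- The triangle Fubini identity `∫₀ᵗ (∫₀ˢ a) ds = ∫₀ᵗ (t - r) a(r) dr` for bounded measurable `a`
and `t ≥ 0`. [folklore] -/
theorem integral_integral_triangle_eq {a : ℝ → ℝ} (ha : Measurable a) {B : ℝ} (hB : ∀ r, |a r| ≤ B)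
    {t : ℝ} (ht : 0 ≤ t) :
    ∫ s in (0 : ℝ)..t, (∫ r in (0 : ℝ)..s, a r) = ∫ r in (0 : ℝ)..t, (t - r) * a r := by
  -- write the inner integral with an indicator on the fixed interval `(0, t]`
  have hinner : ∀ s ∈ Ioc 0 t, ∫ r in (0 : ℝ)..s, a r = ∫ r in Ioc 0 t, (Iic s).indicator a r := by
    intro s hs
    rw [integral_of_le hs.1.le, setIntegral_indicator measurableSet_Iic]
    have hset : Ioc 0 t ∩ Iic s = Ioc 0 s := by
      ext r
      simp only [mem_Ioc, mem_inter_iff, mem_Iic]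
      constructor
      · rintro ⟨⟨h1, -⟩, h2⟩; exact ⟨h1, h2⟩
      · rintro ⟨h1, h2⟩; exact ⟨⟨h1, h2.trans hs.2⟩, h2⟩
    rw [hset]
  rw [integral_of_le ht, setIntegral_congr_fun measurableSet_Ioc hinner]
  -- swap the two integrals over `(0, t]`
  set G : ℝ → ℝ → ℝ := fun s r => (Iic s).indicator a r with hG
  have hGm : Measurable (Function.uncurry G) := by
    have h1 : Function.uncurry G = fun p : ℝ × ℝ => if p.2 ≤ p.1 then a p.2 else 0 := by
      funext p
      simp only [Function.uncurry, hG, Set.indicator_apply, mem_Iic]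
    rw [h1]
    exact Measurable.ite (measurableSet_le measurable_snd measurable_fst) (ha.comp measurable_snd)
      measurable_const
  have hGb : ∀ p : ℝ × ℝ, ‖Function.uncurry G p‖ ≤ |B| := by
    intro p
    simp only [Function.uncurry, hG, Set.indicator_apply, mem_Iic, Real.norm_eq_abs]
    split_ifs
    · exact (hB _).trans (le_abs_self B)
    · simp
  haveI : IsFiniteMeasure ((volume : Measure ℝ).restrict (Ioc 0 t)) := by
    refine ⟨?_⟩
    rw [Measure.restrict_apply_univ]
    exact measure_Ioc_lt_top
  have hGi : Integrable (Function.uncurry G)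
      (((volume : Measure ℝ).restrict (Ioc 0 t)).prod ((volume : Measure ℝ).restrict (Ioc 0 t))) :=
    Integrable.of_bound hGm.aestronglyMeasurable |B| (Eventually.of_forall hGb)
  rw [integral_integral_swap hGi]
  -- evaluate the inner integral: `∫_{(0,t]} 1_{r ≤ s} a(r) ds = (t - r) a(r)` for `r ∈ (0, t]`
  have hval : ∀ r ∈ Ioc 0 t, ∫ s in Ioc 0 t, G s r = (t - r) * a r := by
    intro r hr
    have h1 : (fun s => G s r) = (Ici r).indicator (fun _ => a r) := by
      funext s
      simp only [hG, Set.indicator_apply, mem_Iic, mem_Ici]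
    rw [h1, integral_indicator_const _ measurableSet_Ici]
    simp only [smul_eq_mul]
    rw [measureReal_restrict_apply measurableSet_Ici]
    have h2 : Ici r ∩ Ioc 0 t = Icc r t := by
      ext s
      simp only [mem_inter_iff, mem_Ici, mem_Ioc, mem_Icc]
      constructor
      · rintro ⟨h1, -, h3⟩; exact ⟨h1, h3⟩
      · rintro ⟨h1, h3⟩; exact ⟨h1, lt_of_lt_of_le hr.1 h1, h3⟩
    rw [h2, Real.volume_real_Icc_of_le hr.2]
  rw [setIntegral_congr_fun measurableSet_Ioc hval, ← integral_of_le ht]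

/-- **Integral of a lag function over a square.** For bounded measurable `a, b : ℝ → ℝ` and `t ≥ 0`, with
`F(s,u) = a(u - s)` for `s < u` and `F(s,u) = b(s - u)` for `u ≤ s`,
`∫∫_{(0,t]²} F(s,u) du ds = ∫₀ᵗ (t - r) (a(r) + b(r)) dr`. [folklore] -/
theorem setIntegral_square_lag_eq {a b : ℝ → ℝ} (ha : Measurable a) (hb : Measurable b) {B : ℝ}
    (haB : ∀ r, |a r| ≤ B) (hbB : ∀ r, |b r| ≤ B) {t : ℝ} (ht : 0 ≤ t) :
    ∫ z in Ioc 0 t ×ˢ Ioc 0 t, (if z.1 < z.2 then a (z.2 - z.1) else b (z.1 - z.2)) ∂(volume.prod volume) =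
      ∫ r in (0 : ℝ)..t, (t - r) * (a r + b r) := by
  set F : ℝ × ℝ → ℝ := fun z => if z.1 < z.2 then a (z.2 - z.1) else b (z.1 - z.2) with hF
  have hFm : Measurable F :=
    Measurable.ite (measurableSet_lt measurable_fst measurable_snd) (ha.comp (measurable_snd.sub measurable_fst))
      (hb.comp (measurable_fst.sub measurable_snd))
  have hFb : ∀ z, ‖F z‖ ≤ |B| := by
    intro z
    simp only [hF, Real.norm_eq_abs]
    split_ifs
    · exact (haB _).trans (le_abs_self B)
    · exact (hbB _).trans (le_abs_self B)
  have hfin : (volume.prod volume) (Ioc (0 : ℝ) t ×ˢ Ioc (0 : ℝ) t) < ∞ := by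
    rw [Measure.prod_prod]
    exact ENNReal.mul_lt_top measure_Ioc_lt_top measure_Ioc_lt_top
  have hFi : IntegrableOn F (Ioc 0 t ×ˢ Ioc 0 t) (volume.prod volume) :=
    IntegrableOn.of_bound hfin hFm.aestronglyMeasurable |B| (Eventually.of_forall hFb)
  rw [setIntegral_prod F hFi]
  -- the inner integral at fixed `s ∈ (0, t]`
  have hinner : ∀ s ∈ Ioc 0 t, ∫ u in Ioc 0 t, F (s, u) =
      (∫ r in (0 : ℝ)..s, b r) + ∫ r in (0 : ℝ)..(t - s), a r := by
    intro s hs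
    have hs0 : 0 ≤ s := hs.1.le
    have hI1 : IntervalIntegrable (fun u => F (s, u)) volume 0 s :=
      intervalIntegrable_of_bounded_measurable (hFm.comp (measurable_const.prodMk measurable_id))
        (fun u => by simpa [Real.norm_eq_abs] using (hFb (s, u)).trans (le_refl |B|)) 0 s
    have hI2 : IntervalIntegrable (fun u => F (s, u)) volume s t :=
      intervalIntegrable_of_bounded_measurable (hFm.comp (measurable_const.prodMk measurable_id))
        (fun u => by simpa [Real.norm_eq_abs] using (hFb (s, u)).trans (le_refl |B|)) s t
    rw [← integral_of_le ht, ← integral_add_adjacent_intervals hI1 hI2]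
    congr 1
    · -- on `(0, s]`: `u ≤ s`, so `F = b(s - u)`
      rw [integral_of_le hs0, integral_of_le hs0]
      have h1 : ∫ u in Ioc 0 s, F (s, u) = ∫ u in Ioc 0 s, b (s - u) := by
        refine setIntegral_congr_fun measurableSet_Ioc fun u hu => ?_
        simp only [hF]
        rw [if_neg (not_lt.2 hu.2)]
      rw [h1, ← integral_of_le hs0, ← integral_of_le hs0, intervalIntegral.integral_comp_sub_left b s]
      simp
    · -- on `(s, t]`: `s < u`, so `F = a(u - s)`
      rw [integral_of_le hs.2]
      have h1 : ∫ u in Ioc s t, F (s, u) = ∫ u in Ioc s t, a (u - s) := by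
        refine setIntegral_congr_fun measurableSet_Ioc fun u hu => ?_
        simp only [hF]
        rw [if_pos hu.1]
      rw [h1, ← integral_of_le hs.2, intervalIntegral.integral_comp_sub_right a s]
      simp
  rw [setIntegral_congr_fun measurableSet_Ioc hinner, ← integral_of_le ht]
  -- the outer integral
  have hIb : ∀ x y, IntervalIntegrable b volume x y := intervalIntegrable_of_bounded_measurable hb hbB
  have hIa : ∀ x y, IntervalIntegrable a volume x y := intervalIntegrable_of_bounded_measurable ha haB
  have hBc : Continuous fun s => ∫ r in (0 : ℝ)..s, b r := continuous_primitive hIb 0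
  have hAc : Continuous fun s => ∫ r in (0 : ℝ)..s, a r := continuous_primitive hIa 0
  have hAc' : Continuous fun s => ∫ r in (0 : ℝ)..(t - s), a r := hAc.comp (continuous_const.sub continuous_id)
  rw [intervalIntegral.integral_add (hBc.intervalIntegrable _ _) (hAc'.intervalIntegrable _ _),
    intervalIntegral.integral_comp_sub_left (fun s => ∫ r in (0 : ℝ)..s, a r) t]
  simp only [sub_self, sub_zero]
  rw [integral_integral_triangle_eq hb hbB ht, integral_integral_triangle_eq ha haB ht]
  have hlin : Continuous fun r : ℝ => t - r := continuous_const.sub continuous_id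
  have hi1 : IntervalIntegrable (fun r => (t - r) * a r) volume 0 t := (hIa 0 t).continuousOn_mul hlin.continuousOn
  have hi2 : IntervalIntegrable (fun r => (t - r) * b r) volume 0 t := (hIb 0 t).continuousOn_mul hlin.continuousOn
  rw [← intervalIntegral.integral_add hi2 hi1]
  refine intervalIntegral.integral_congr fun r _ => ?_
  ring

/-! ### Two pointwise inequalities -/

/-- `|ab| ≤ a² + b²`. [folklore] -/
theorem abs_mul_le_sq_add_sq (a b : ℝ) : |a * b| ≤ a ^ 2 + b ^ 2 := by
  rw [abs_mul]
  nlinarith [sq_nonneg (|a| - |b|), sq_abs a, sq_abs b, abs_nonneg a, abs_nonneg b]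

/-- `xy ≤ x² + y²` in `ℝ≥0∞`. [folklore] -/
theorem ennreal_mul_le_sq_add_sq (x y : ℝ≥0∞) : x * y ≤ x ^ 2 + y ^ 2 := by
  rcases le_total x y with hxy | hxy
  · calc x * y ≤ y * y := by gcongr
      _ = y ^ 2 := (sq y).symm
      _ ≤ x ^ 2 + y ^ 2 := le_add_self
  · calc x * y ≤ x * x := by gcongr
      _ = x ^ 2 := (sq x).symm
      _ ≤ x ^ 2 + y ^ 2 := le_self_add

/-! ### One-time laws of the constructed flow and moments along it -/

section Flow

variable {ω₂ lam β γ : ℝ} (hω : 0 < ω₂) (hl : 0 ≤ lam) (hβ : 0 ≤ β) (hγ : 0 ≤ γ) (N : ℕ) (T_L T_R : ℝ)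
include hω hl hβ hγ

omit hω hl hβ hγ in
/-- The solution map at a real time `r` is the solution map at `r⁺` (it is clamped to the initial
condition on `(-∞, 0]`). [folklore] -/
theorem pinnedChain_solMap_eq_solMap_toNNReal (r : ℝ) (x : PhaseSpace N) (w : WienerPair) :
    (pinnedChain ω₂ lam β γ).solMap N T_L T_R r x w =
      (pinnedChain ω₂ lam β γ).solMap N T_L T_R ((r.toNNReal : ℝ≥0) : ℝ) x w := by
  rcases le_total 0 r with hr | hr
  · rw [Real.coe_toNNReal r hr]
  · rw [Real.toNNReal_of_nonpos hr, NNReal.coe_zero,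
      pinnedChain_solMap_of_nonpos N T_L T_R x w hr, pinnedChain_solMap_of_nonpos N T_L T_R x w le_rfl]

/-- The process `(r, (x, ω)) ↦ Φ_r(x, B(ω))` is jointly measurable. [folklore] -/
theorem pinnedChain_measurable_solMap_process :
    Measurable fun q : ℝ × (PhaseSpace N × WienerPair) =>
      (pinnedChain ω₂ lam β γ).solMap N T_L T_R q.1 q.2.1 (pairPath q.2.2) := by
  have h1 : Measurable fun q : ℝ × (PhaseSpace N × WienerPair) => (q.1, (q.2.1, pairPath q.2.2)) :=
    measurable_fst.prodMk ((measurable_fst.comp measurable_snd).prodMk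
      (measurable_pairPath.comp (measurable_snd.comp measurable_snd)))
  have h := (pinnedChain_measurable_uncurry_solMap hω hl hβ hγ N T_L T_R).comp h1
  exact h

/-- **One-time law from an initial distribution**: under `μ ⊗ W` the law of `z_s = Φ_s(x, B(ω))` is
`μP_s = μ.bind P_s`. [folklore] -/
theorem pinnedChain_map_solMap_of_initial (μ : Measure (PhaseSpace N)) [SFinite μ] (s : ℝ≥0) :
    (μ.prod wienerPair).map (fun p => (pinnedChain ω₂ lam β γ).solMap N T_L T_R s p.1 (pairPath p.2)) =
      μ.bind ((pinnedChain ω₂ lam β γ).transitionKernel N T_L T_R s) := by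
  have hm := pinnedChain_measurable_solMap_pairPath hω hl hβ hγ N T_L T_R (s : ℝ)
  refine Measure.ext fun A hA => ?_
  rw [Measure.map_apply hm hA, Measure.prod_apply (hm hA),
    Measure.bind_apply hA ((pinnedChain ω₂ lam β γ).transitionKernel N T_L T_R s).measurable.aemeasurable]
  refine lintegral_congr fun x => ?_
  rw [pinnedChain_transitionKernel_apply' hω hl hβ hγ N T_L T_R s x hA]
  rfl

/-- **One-time law under an invariant initial distribution**: `law(z_s) = μ`. [folklore] -/
theorem pinnedChain_map_solMap_of_invariant (μ : Measure (PhaseSpace N)) [SFinite μ] (s : ℝ≥0)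
    (hinv : μ.bind ((pinnedChain ω₂ lam β γ).transitionKernel N T_L T_R s) = μ) :
    (μ.prod wienerPair).map (fun p => (pinnedChain ω₂ lam β γ).solMap N T_L T_R s p.1 (pairPath p.2)) = μ := by
  rw [pinnedChain_map_solMap_of_initial hω hl hβ hγ N T_L T_R μ s, hinv]

/-- Second moments along the stationary flow: `E‖f(z_r)‖² = ∫ ‖f‖² dμ` for every real `r` (Lebesgue
form). [folklore] -/
theorem pinnedChain_lintegral_sq_solMap_of_invariant (μ : Measure (PhaseSpace N)) [SFinite μ]
    (hinv : ∀ s : ℝ≥0, μ.bind ((pinnedChain ω₂ lam β γ).transitionKernel N T_L T_R s) = μ)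
    {f : PhaseSpace N → ℝ} (hf : Measurable f) (r : ℝ) :
    ∫⁻ p, ‖f ((pinnedChain ω₂ lam β γ).solMap N T_L T_R r p.1 (pairPath p.2))‖ₑ ^ 2 ∂(μ.prod wienerPair) =
      ∫⁻ y, ‖f y‖ₑ ^ 2 ∂μ := by
  have hm := pinnedChain_measurable_solMap_pairPath hω hl hβ hγ N T_L T_R ((r.toNNReal : ℝ≥0) : ℝ)
  have hg : Measurable fun y => ‖f y‖ₑ ^ 2 := hf.enorm.pow_const 2
  calc ∫⁻ p, ‖f ((pinnedChain ω₂ lam β γ).solMap N T_L T_R r p.1 (pairPath p.2))‖ₑ ^ 2 ∂(μ.prod wienerPair)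
      = ∫⁻ p, ‖f ((pinnedChain ω₂ lam β γ).solMap N T_L T_R ((r.toNNReal : ℝ≥0) : ℝ) p.1 (pairPath p.2))‖ₑ ^ 2
          ∂(μ.prod wienerPair) := by
        refine lintegral_congr fun p => ?_
        rw [pinnedChain_solMap_eq_solMap_toNNReal N T_L T_R r]
    _ = ∫⁻ y, ‖f y‖ₑ ^ 2 ∂((μ.prod wienerPair).map
          (fun p => (pinnedChain ω₂ lam β γ).solMap N T_L T_R ((r.toNNReal : ℝ≥0) : ℝ) p.1 (pairPath p.2))) :=
        (lintegral_map hg hm).symm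
    _ = ∫⁻ y, ‖f y‖ₑ ^ 2 ∂μ := by
        rw [pinnedChain_map_solMap_of_invariant hω hl hβ hγ N T_L T_R μ _ (hinv _)]

/-- Integrability along the stationary flow: `f(z_r) ∈ L²(μ ⊗ W)` if `f ∈ L²(μ)`, with
`E f(z_r)² = ∫ f² dμ`. [folklore] -/
theorem pinnedChain_integrable_sq_solMap_of_invariant (μ : Measure (PhaseSpace N)) [SFinite μ]
    (hinv : ∀ s : ℝ≥0, μ.bind ((pinnedChain ω₂ lam β γ).transitionKernel N T_L T_R s) = μ)
    {f : PhaseSpace N → ℝ} (hf2 : Integrable (fun y => f y ^ 2) μ) (r : ℝ) :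
    Integrable (fun p => f ((pinnedChain ω₂ lam β γ).solMap N T_L T_R r p.1 (pairPath p.2)) ^ 2) (μ.prod wienerPair) ∧
    ∫ p, f ((pinnedChain ω₂ lam β γ).solMap N T_L T_R r p.1 (pairPath p.2)) ^ 2 ∂(μ.prod wienerPair) =
      ∫ y, f y ^ 2 ∂μ := by
  have hm := pinnedChain_measurable_solMap_pairPath hω hl hβ hγ N T_L T_R ((r.toNNReal : ℝ≥0) : ℝ)
  have hlaw := pinnedChain_map_solMap_of_invariant hω hl hβ hγ N T_L T_R μ _ (hinv (r.toNNReal))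
  have heq : (fun p : PhaseSpace N × WienerPair => f ((pinnedChain ω₂ lam β γ).solMap N T_L T_R r p.1 (pairPath p.2)) ^ 2) =
      (fun y => f y ^ 2) ∘
        (fun p => (pinnedChain ω₂ lam β γ).solMap N T_L T_R ((r.toNNReal : ℝ≥0) : ℝ) p.1 (pairPath p.2)) := by
    funext p
    simp only [Function.comp_apply]
    rw [pinnedChain_solMap_eq_solMap_toNNReal N T_L T_R r]
  have hf2' : Integrable (fun y => f y ^ 2) ((μ.prod wienerPair).map
      (fun p => (pinnedChain ω₂ lam β γ).solMap N T_L T_R ((r.toNNReal : ℝ≥0) : ℝ) p.1 (pairPath p.2))) := by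
    rw [hlaw]; exact hf2
  refine ⟨?_, ?_⟩
  · rw [heq]
    exact (integrable_map_measure hf2'.aestronglyMeasurable hm.aemeasurable).1 hf2'
  · calc ∫ p, f ((pinnedChain ω₂ lam β γ).solMap N T_L T_R r p.1 (pairPath p.2)) ^ 2 ∂(μ.prod wienerPair)
        = ∫ p, f ((pinnedChain ω₂ lam β γ).solMap N T_L T_R ((r.toNNReal : ℝ≥0) : ℝ) p.1 (pairPath p.2)) ^ 2
            ∂(μ.prod wienerPair) := by
          refine integral_congr_ae (Eventually.of_forall fun p => ?_)
          simp only
          rw [pinnedChain_solMap_eq_solMap_toNNReal N T_L T_R r]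
      _ = ∫ y, f y ^ 2 ∂((μ.prod wienerPair).map
            (fun p => (pinnedChain ω₂ lam β γ).solMap N T_L T_R ((r.toNNReal : ℝ≥0) : ℝ) p.1 (pairPath p.2))) :=
          (integral_map hm.aemeasurable hf2'.aestronglyMeasurable).symm
      _ = ∫ y, f y ^ 2 ∂μ := by rw [hlaw]

/-- Integrability of `f ⊗ h` against `μ ⊗ₘ P_t` for `f, h ∈ L²(μ)` and `μ` invariant at time `t`
(`|fh| ≤ f² + h²`, the marginals of `μ ⊗ₘ P_t` being `μ` and `μP_t = μ`). [folklore] -/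
theorem pinnedChain_integrable_mul_compProd_of_invariant (μ : Measure (PhaseSpace N)) [SFinite μ] (t : ℝ≥0)
    (hinv : μ.bind ((pinnedChain ω₂ lam β γ).transitionKernel N T_L T_R t) = μ)
    {f h : PhaseSpace N → ℝ} (hf : Measurable f) (hh : Measurable h)
    (hf2 : Integrable (fun y => f y ^ 2) μ) (hh2 : Integrable (fun y => h y ^ 2) μ) :
    Integrable (fun q : PhaseSpace N × PhaseSpace N => f q.1 * h q.2)
      (μ ⊗ₘ ((pinnedChain ω₂ lam β γ).transitionKernel N T_L T_R t)) := by
  set κ := (pinnedChain ω₂ lam β γ).transitionKernel N T_L T_R t with hκ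
  haveI : IsMarkovKernel κ := pinnedChain_isMarkovKernel_transitionKernel hω hl hβ hγ N T_L T_R t
  have hfst : (μ ⊗ₘ κ).map Prod.fst = μ := Measure.fst_compProd μ κ
  have hsnd : (μ ⊗ₘ κ).map Prod.snd = μ := by
    have h := Measure.snd_compProd μ κ
    rw [hinv] at h
    exact h
  have h1 : Integrable (fun q : PhaseSpace N × PhaseSpace N => f q.1 ^ 2) (μ ⊗ₘ κ) := by
    have hf2' : Integrable (fun y => f y ^ 2) ((μ ⊗ₘ κ).map Prod.fst) := by rw [hfst]; exact hf2
    exact (integrable_map_measure hf2'.aestronglyMeasurable measurable_fst.aemeasurable).1 hf2'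
  have h2 : Integrable (fun q : PhaseSpace N × PhaseSpace N => h q.2 ^ 2) (μ ⊗ₘ κ) := by
    have hh2' : Integrable (fun y => h y ^ 2) ((μ ⊗ₘ κ).map Prod.snd) := by rw [hsnd]; exact hh2
    exact (integrable_map_measure hh2'.aestronglyMeasurable measurable_snd.aemeasurable).1 hh2'
  refine (h1.add h2).mono' ((hf.comp measurable_fst).mul (hh.comp measurable_snd)).aestronglyMeasurable ?_
  exact Eventually.of_forall fun q => by
    simpa [Real.norm_eq_abs] using abs_mul_le_sq_add_sq (f q.1) (h q.2)

/-- **Stationary two-time correlations at real times**: for `0 ≤ s ≤ u` and `f, h ∈ L²(μ)`,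
`E_{μ⊗W}[f(z_s) h(z_u)] = ∫ f · (P_{u-s} h) dμ`. [folklore] -/
theorem pinnedChain_integral_mul_solMap_of_invariant (μ : Measure (PhaseSpace N)) [SFinite μ]
    (hinv : ∀ s : ℝ≥0, μ.bind ((pinnedChain ω₂ lam β γ).transitionKernel N T_L T_R s) = μ)
    {f h : PhaseSpace N → ℝ} (hf : Measurable f) (hh : Measurable h)
    (hf2 : Integrable (fun y => f y ^ 2) μ) (hh2 : Integrable (fun y => h y ^ 2) μ)
    {s u : ℝ} (hs : 0 ≤ s) (hsu : s ≤ u) :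
    ∫ p, f ((pinnedChain ω₂ lam β γ).solMap N T_L T_R s p.1 (pairPath p.2)) *
        h ((pinnedChain ω₂ lam β γ).solMap N T_L T_R u p.1 (pairPath p.2)) ∂(μ.prod wienerPair) =
      ∫ y, f y * (∫ y', h y' ∂((pinnedChain ω₂ lam β γ).transitionKernel N T_L T_R (u - s).toNNReal y)) ∂μ := by
  have hhf := pinnedChain_integrable_mul_compProd_of_invariant hω hl hβ hγ N T_L T_R μ (u - s).toNNReal
    (hinv _) hf hh hf2 hh2
  have key := pinnedChain_integral_solMap_pair_of_invariant hω hl hβ hγ N T_L T_R μ s.toNNReal (u - s).toNNReal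
    (hinv _) hhf
  have e1 : ((s.toNNReal : ℝ≥0) : ℝ) = s := Real.coe_toNNReal s hs
  have e2 : ((s.toNNReal + (u - s).toNNReal : ℝ≥0) : ℝ) = u := by
    rw [NNReal.coe_add, Real.coe_toNNReal s hs, Real.coe_toNNReal _ (sub_nonneg.2 hsu)]
    ring
  rw [e1, e2] at key
  exact key

end Flow

/-- **One-time law of the constructed flow** (registered sub-goal of `stub_bathBondReduction`; closed form of
`pinnedChain_map_solMap_of_initial`): for the pinned chain (`ω₂ > 0`, `lam, β, γ ≥ 0`), every s-finite
initial law `μ`, all `N, T_L, T_R` and `s ≥ 0`, the law of `z_s = Φ_s(x, B(ω))` under `μ ⊗ W` is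
`μ.bind P_s`. [folklore] -/
theorem pinnedChain_oneTimeLaw :
    ∀ (ω₂ lam β γ : ℝ), 0 < ω₂ → 0 ≤ lam → 0 ≤ β → 0 ≤ γ → ∀ (N : ℕ) (T_L T_R : ℝ)
      (μ : MeasureTheory.Measure (PhaseSpace N)) [MeasureTheory.SFinite μ] (s : NNReal),
      (μ.prod Literature.Probability.Process.wienerPair).map
          (fun p => (pinnedChain ω₂ lam β γ).solMap N T_L T_R s p.1 (Literature.Probability.Process.pairPath p.2)) =
        μ.bind ((pinnedChain ω₂ lam β γ).transitionKernel N T_L T_R s) := by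
  intro ω₂ lam β γ hω hl hβ hγ N T_L T_R μ _ s
  exact pinnedChain_map_solMap_of_initial hω hl hβ hγ N T_L T_R μ s

end Summit.AtomisticToContinuum.FouriersLaw.Theorems.SubdiffusiveBondHeat
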